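import Summits.BirchSwinnertonDyer.Rank1Residual.X11b.CertificateRecordsGenericSurjChecks
import HarnessLib

/-!
# BSD rank-≤1 residual cell, class X11b ∧ r = 1 ∧ p ≥ 5 WITHOUT a (ram) prime (`ρ̄_{E,p}` onto):
# from `fullCheckSurj` and the three engine numbers to `BSD(E,p)` (Kato–Wuthrich surjective-image
# divisibility A32 instead of Skinner 2016 Thm. A) — soundness of the check, proved once

HONEST FRAMING (cell `b2b-bsdres-*`, verbatim): prove what is provable now; shrink each hard class
to its core with data; no claim beyond stated classes; COMBINATION classes deleted from PUBLISHED
theorems only, CONSTRUCTION-shaped remainder typed; this is not "finishing BSD". Class X11b stays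
CONSTRUCTION-SHAPED; everything here is PER PAIR; nothing is booked; no named fact. Unit
`b2b-bsdres-x11c` (gen 10). Theorems only.

For a record `r` (schema `X11RankOneCertificates.Record`) with `fullCheckSurj r = true`
(`CertificateRecordsGenericSurjChecks.lean`: support, Kraus/Silverman minimality, `Mult` + split type,
a Frobenius irreducibility witness, an additive prime, and `Surj` by the integer valuation test or
Serre's three witnesses), the published facts — Kato–Wuthrich divisibility for surjective `ρ_{E,p^∞}`
(`kato_charIdeal_dvd_multiplicative_of_surjective`, A32; Serre 1968 IV §3.4 lifts `Surj` at `p ≥ 5`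
to all `p^n`, tree theorem), Stein–Wuthrich 2013 Thm. 6.1 split/non-split (A37), §4.2 height
existence (A38), Wuthrich 2014 Prop. 21, GZK (A18), modularity — and the three engine numbers
(analytic rank `1`, `#Ш_an` as recorded, the two-engine `p`-adic certificate `CertSplit` /
`CertNonsplit`) give Miller's `BSD(E,p)` through the consumer of record
`Typed.X11.bsdp_of_katoSurj_{split,nonsplit}_of_surjective_pow_of_certificate` (the route of the 11
(ram)-free in-window records, `X11RankOneCertificates.Claim` / `Rank1ResidualX11RankOneCore`);
`bsdp_of_all_fullCheckSurj` is the batch form (`rs.all fullCheckSurj = true`, one `decide`).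

References: C. Wuthrich, J. London Math. Soc. 90 (2014) Thm. 3, Cor. 19, Prop. 21 [Wuthrich2014];
W. Stein and C. Wuthrich, Math. Comp. 82 (2013) Thm. 6.1, Thm. 7.3, §4.2 [SteinWuthrich2013];
B. Mazur, J. Tate, J. Teitelbaum, Invent. Math. 84 (1986) [MazurTateTeitelbaum1986Invent];
J.-P. Serre, Invent. Math. 15 (1972) [Serre1972].
-/

set_option autoImplicit false

noncomputable section

open scoped Classical MatrixGroups ModularForm

open CongruenceSubgroup WeierstrassCurve Literature.NumberTheory.EllipticCurves
  Literature.NumberTheory.EllipticCurves.ModularForms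
  Literature.NumberTheory.EllipticCurves.Rank1Residual
  Literature.NumberTheory.EllipticCurves.Rank1Residual.Typed
  Literature.NumberTheory.EllipticCurves.Skinner2016
  Literature.NumberTheory.EllipticCurves.Wuthrich2014
  Literature.NumberTheory.EllipticCurves.SteinWuthrich2013
  Literature.NumberTheory.EllipticCurves.Rank1Residual.X11RankOneCertificates
  Summit.BirchSwinnertonDyer.BirchSwinnertonDyer.Rank1Residual.IntModel
  Summit.BirchSwinnertonDyer.BirchSwinnertonDyer.Rank1Residual.X11RankOne

namespace Summit.BirchSwinnertonDyer.Rank1Residual.X11b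

/-! ### §3. From `fullCheckSurj` and the three numbers to `BSD(E,p)` -/

section Final

variable (r : Record)

/-- Unpacking `fullCheckSurj`. [folklore] -/
theorem fullCheckSurj_iff : fullCheckSurj r = true ↔
    r.checkSupport = true ∧ minCheck r = true ∧ multCheck r = true ∧ irrCheck r = true ∧
      nsstCheck r = true ∧ surjCheck r = true := by
  simp only [fullCheckSurj, Bool.and_eq_true, and_assoc]

/-- **A record passing `fullCheckSurj`, SPLIT at `p`: the published facts A32 (Kato–Wuthrich
surjective-image divisibility), A37, A38, Wuthrich 2014 Prop. 21, A18 + modularity and the three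
engine numbers give `BSD(E,p)`** (consumer of record
`Typed.X11.bsdp_of_katoSurj_split_of_surjective_pow_of_certificate`, as for the 11 (ram)-free
in-window records; all bookkeeping from the checks and tree theorems).
[cite: Wuthrich2014, Thm. 3 (p. 383), Cor. 19 (p. 398), Prop. 21 (p. 400)]
[cite: SteinWuthrich2013, Thm. 6.1 (p. 20), Thm. 7.3 (p. 22) and §4.2] -/
theorem bsdp_of_fullCheckSurj_split (hc : fullCheckSurj r = true)
    [Fact r.p.Prime] [r.curve.IsElliptic] [r.curve.IsGloballyMinimal]
    (hK : kato_charIdeal_dvd_multiplicative_of_surjective) (hJ : thm61_splitMultiplicative)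
    (hH : exists_isSplitMultCanonical) (hW : Wuthrich2014.sha_dvd_analyticSha)
    (hGZK : rank_eq_analyticRank_of_analyticRank_le_one) (hmod : hasEntireLFunction_rat)
    (hpar : nonempty_modularParametrizationData)
    (hsplit : r.split = true) (hran : r.curve.analyticRank = 1)
    (hsha : Literature.NumberTheory.EllipticCurves.shaAn r.curve = ((r.shaAn : ℚ) : ℂ))
    (hcs : r.CertSplit) : BSDp r.curve r.p := by
  obtain ⟨hs, -, hm, hirr, hn, hsj⟩ := (fullCheckSurj_iff r).mp hc
  obtain ⟨hmult, hsp, -⟩ := mult_of_multCheck r hs hm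
  have hp5 : 5 ≤ r.p := (prime_of_multCheck r hm).2.1
  have hirr' : Irr r.curve r.p := irr_of_irrCheck r hs hirr
  have hnsst : ¬ Semistable r.curve := not_semistable_of_nsstCheck r hs hn
  have hsurj : Surj r.curve r.p := surj_of_surjCheck r hs hp5 hmult hirr' hsj
  have hX : ClassX11 r.curve r.p := ⟨hmult, hirr', Or.inr (Or.inl ⟨hran, hnsst⟩)⟩
  have hsplit' := hsp hsplit
  obtain ⟨κ, hκ, γ, hγ, hγ'⟩ := exists_isCyclotomic_isTopGenerator_isCyclotomicVariable_holds r.p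
  obtain ⟨D⟩ := r.curve.nonempty_selmerDualData_holds κ γ hγ
  haveI : NeZero (r.curve.conductorNorm ℤ) := ⟨(r.curve.conductorNorm_pos_holds).ne'⟩
  obtain ⟨Dm⟩ := hpar r.curve
  obtain ⟨ϖ, hϖpos, hϖ, -⟩ := Dm.exists_rat_mul_realPeriodRat_eq_plusPeriod
  obtain ⟨L, hL⟩ := exists_isSplitMultPAdicLFunctionOf hsplit' Dm.isNewformOf
  obtain ⟨Dq⟩ := (nonempty_tateParameterData_iff_holds (W := r.curve) (p := r.p)).mpr hsplit'
  have hrank : r.curve.mordellWeilRank = 1 := by rw [(hGZK r.curve (le_of_eq hran)).1, hran]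
  obtain ⟨hordL, hcert⟩ := hcs Dm.f ϖ L Dm.isNewformOf hϖ hL
  exact X11.bsdp_of_katoSurj_split_of_surjective_pow_of_certificate hK hJ hH hW hGZK hmod r.curve r.p
    LInvariant_ne_zero_holds (by omega) (le_of_eq hran) hX
    (kato_charIdeal_dvd_multiplicative_of_surjective.surjective_pow_of_five_le r.curve r.p hp5 hsurj)
    Dq hκ hγ hγ' Dm.isNewformOf D ϖ hϖpos.ne' hϖ L hL (by rw [hrank]; exact hordL)
    (fun Dh hDh => by rw [hrank]; exact hcert Dq Dh hDh) hsha
    (padicValRat_shaAn_eq_zero_of_multCheck r hm)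

/-- **A record passing `fullCheckSurj`, NON-SPLIT at `p`: `BSD(E,p)`** likewise (MTT non-split
`p`-adic `L`-function from the tree theorem `exists_isMultPAdicLFunctionOf_neg_one_holds`).
[cite: Wuthrich2014, Thm. 3 (p. 383), Cor. 19 (p. 398), Prop. 21 (p. 400)]
[cite: SteinWuthrich2013, Thm. 6.1 (p. 20), §3.1 (p. 9), Thm. 7.3 (p. 22) and §4.2]
[cite: MazurTateTeitelbaum1986Invent, §I.10–I.14] -/
theorem bsdp_of_fullCheckSurj_nonsplit (hc : fullCheckSurj r = true)
    [Fact r.p.Prime] [r.curve.IsElliptic] [r.curve.IsGloballyMinimal]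
    (hK : kato_charIdeal_dvd_multiplicative_of_surjective) (hJ : thm61_nonsplitMultiplicative)
    (hH : exists_isMultCanonical) (hW : Wuthrich2014.sha_dvd_analyticSha)
    (hGZK : rank_eq_analyticRank_of_analyticRank_le_one) (hmod : hasEntireLFunction_rat)
    (hpar : nonempty_modularParametrizationData)
    (hsplit : r.split = false) (hran : r.curve.analyticRank = 1)
    (hsha : Literature.NumberTheory.EllipticCurves.shaAn r.curve = ((r.shaAn : ℚ) : ℂ))
    (hcn : r.CertNonsplit) : BSDp r.curve r.p := by
  obtain ⟨hs, -, hm, hirr, hn, hsj⟩ := (fullCheckSurj_iff r).mp hc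
  obtain ⟨hmult, -, hnsp⟩ := mult_of_multCheck r hs hm
  have hp5 : 5 ≤ r.p := (prime_of_multCheck r hm).2.1
  have hirr' : Irr r.curve r.p := irr_of_irrCheck r hs hirr
  have hnsst : ¬ Semistable r.curve := not_semistable_of_nsstCheck r hs hn
  have hsurj : Surj r.curve r.p := surj_of_surjCheck r hs hp5 hmult hirr' hsj
  have hX : ClassX11 r.curve r.p := ⟨hmult, hirr', Or.inr (Or.inl ⟨hran, hnsst⟩)⟩
  have hns := hnsp hsplit
  obtain ⟨κ, hκ, γ, hγ, hγ'⟩ := exists_isCyclotomic_isTopGenerator_isCyclotomicVariable_holds r.p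
  obtain ⟨D⟩ := r.curve.nonempty_selmerDualData_holds κ γ hγ
  haveI : NeZero (r.curve.conductorNorm ℤ) := ⟨(r.curve.conductorNorm_pos_holds).ne'⟩
  obtain ⟨Dm⟩ := hpar r.curve
  obtain ⟨ϖ, hϖpos, hϖ, -⟩ := Dm.exists_rat_mul_realPeriodRat_eq_plusPeriod
  obtain ⟨L, hL⟩ := exists_isMultPAdicLFunctionOf_neg_one_holds r.curve r.p Dm.f hmult hns Dm.isNewformOf
  obtain ⟨q, ⟨hq0, hq1, hqj⟩, -⟩ := existsUnique_tateJ_eq_of_one_lt_norm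
    (one_lt_norm_j_of_hasMultiplicativeReductionAtPrime (W := r.curve) (p := r.p) hmult)
  have hrank : r.curve.mordellWeilRank = 1 := by rw [(hGZK r.curve (le_of_eq hran)).1, hran]
  obtain ⟨hordL, hcert⟩ := hcn Dm.f ϖ L Dm.isNewformOf hϖ hL
  exact X11.bsdp_of_katoSurj_nonsplit_of_surjective_pow_of_certificate hK hJ hH hW hGZK hmod r.curve r.p
    (by omega) (le_of_eq hran) hX
    (kato_charIdeal_dvd_multiplicative_of_surjective.surjective_pow_of_five_le r.curve r.p hp5 hsurj)
    hns hq0 hq1 hqj hκ hγ hγ' Dm.isNewformOf D ϖ hϖpos.ne' hϖ L hL (by rw [hrank]; exact hordL)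
    (fun Dh hDh => by rw [hrank, pow_one]; simpa using hcert q hq0 hq1 hqj Dh hDh) hsha
    (padicValRat_shaAn_eq_zero_of_multCheck r hm)

/-- **SOUNDNESS OF `fullCheckSurj` — the whole per-pair content of a (ram)-free certificate record.**
For a record `r` with `fullCheckSurj r = true` (kernel-evaluated): Kato–Wuthrich surjective-image
divisibility `hK`, Stein–Wuthrich 2013 Thm. 6.1 `hJs`/`hJn`, SW §4.2 height existence `hHs`/`hHn`,
Wuthrich 2014 Prop. 21 `hW`, GZK `hGZK`, modularity `hmod`/`hpar` (published named facts) and the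
three engine numbers — analytic rank `= 1`, `#Ш_an` as recorded, the two-engine `p`-adic certificate
— give Miller's `BSD(E,p)` for `r.curve`. `p` prime, `Δ ≠ 0`, global minimality, `Mult`, split type,
`¬sst`, `Irr`, `Surj` are all read off the check. Per pair; class label unchanged.
[cite: Wuthrich2014, Thm. 3 (p. 383), Cor. 19 (p. 398), Prop. 21 (p. 400)]
[cite: SteinWuthrich2013, Thm. 6.1 (p. 20), Thm. 7.3 (p. 22) and §4.2] [cite: Serre1972, §1.12 and §2.8 Prop. 19]
[cite: Mazur1978, §6 Prop. 6.3 (1) (p. 153)] -/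
theorem bsdp_of_fullCheckSurj (hc : fullCheckSurj r = true)
    (hK : kato_charIdeal_dvd_multiplicative_of_surjective)
    (hJs : thm61_splitMultiplicative) (hJn : thm61_nonsplitMultiplicative)
    (hHs : exists_isSplitMultCanonical) (hHn : exists_isMultCanonical)
    (hW : Wuthrich2014.sha_dvd_analyticSha) (hGZK : rank_eq_analyticRank_of_analyticRank_le_one)
    (hmod : hasEntireLFunction_rat) (hpar : nonempty_modularParametrizationData)
    (hnum : ∀ [Fact r.p.Prime] [r.curve.IsElliptic] [r.curve.IsGloballyMinimal],
        r.curve.analyticRank = 1 ∧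
        Literature.NumberTheory.EllipticCurves.shaAn r.curve = ((r.shaAn : ℚ) : ℂ) ∧
        (r.split = true → r.CertSplit) ∧ (r.split = false → r.CertNonsplit)) :
    ∀ [Fact r.p.Prime] [r.curve.IsElliptic] [r.curve.IsGloballyMinimal], BSDp r.curve r.p := by
  intro _ _ _
  obtain ⟨hran, hsha, hcs, hcn⟩ := hnum
  cases hsp : r.split
  · exact bsdp_of_fullCheckSurj_nonsplit r hc hK hJn hHn hW hGZK hmod hpar hsp hran hsha (hcn hsp)
  · exact bsdp_of_fullCheckSurj_split r hc hK hJs hHs hW hGZK hmod hpar hsp hran hsha (hcs hsp)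

/-- The instance facts of a record passing `fullCheckSurj`: `p` prime, `Δ ≠ 0`, global minimality —
all from the check. [folklore] -/
theorem instances_of_fullCheckSurj (hc : fullCheckSurj r = true) :
    r.p.Prime ∧ r.curve.IsElliptic ∧ r.curve.IsGloballyMinimal := by
  obtain ⟨hs, hmin, hm, -⟩ := (fullCheckSurj_iff r).mp hc
  exact ⟨(prime_of_multCheck r hm).1, isElliptic_of_checkSupport r hs,
    isGloballyMinimal_of_minCheck r hs hmin⟩

/-- **Batch form**: for a list `rs` with `rs.all fullCheckSurj = true` (one `decide` per batch file),
every listed record's curve satisfies `BSD(E,p)` given the published facts and its three numbers —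
with NO instance hypothesis. [cite: Wuthrich2014, Thm. 3 (p. 383), Cor. 19 (p. 398), Prop. 21 (p. 400)]
[cite: SteinWuthrich2013, Thm. 6.1 (p. 20) and §4.2] -/
theorem bsdp_of_all_fullCheckSurj {rs : List Record} (hall : rs.all fullCheckSurj = true)
    (hK : kato_charIdeal_dvd_multiplicative_of_surjective)
    (hJs : thm61_splitMultiplicative) (hJn : thm61_nonsplitMultiplicative)
    (hHs : exists_isSplitMultCanonical) (hHn : exists_isMultCanonical)
    (hW : Wuthrich2014.sha_dvd_analyticSha) (hGZK : rank_eq_analyticRank_of_analyticRank_le_one)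
    (hmod : hasEntireLFunction_rat) (hpar : nonempty_modularParametrizationData)
    (hnum : ∀ r ∈ rs, ∀ [Fact r.p.Prime] [r.curve.IsElliptic] [r.curve.IsGloballyMinimal],
        r.curve.analyticRank = 1 ∧
        Literature.NumberTheory.EllipticCurves.shaAn r.curve = ((r.shaAn : ℚ) : ℂ) ∧
        (r.split = true → r.CertSplit) ∧ (r.split = false → r.CertNonsplit))
    (r : Record) (hr : r ∈ rs) :
    ∃ (_ : Fact r.p.Prime) (_ : r.curve.IsElliptic) (_ : r.curve.IsGloballyMinimal), BSDp r.curve r.p := by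
  have hc : fullCheckSurj r = true := List.all_eq_true.mp hall r hr
  obtain ⟨hp, hE, hM⟩ := instances_of_fullCheckSurj r hc
  haveI : Fact r.p.Prime := ⟨hp⟩
  haveI := hE
  haveI := hM
  exact ⟨inferInstance, hE, hM, bsdp_of_fullCheckSurj r hc hK hJs hJn hHs hHn hW hGZK hmod hpar (hnum r hr)⟩

end Final

end Summit.BirchSwinnertonDyer.Rank1Residual.X11b

end
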